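import Mathlib.RingTheory.Polynomial.Tower
import Literature.NumberTheory.EllipticCurves.TateModuleKernelIndexProofs
import Literature.Algebra.Polynomial.CharpolyOfMultiplicativeDegree
import HarnessLib

/-!
# The characteristic polynomial of `T_p(φ)` from a degree function (Milne, *Abelian Varieties*, Prop. 12.9)

Sibling proof file (theorems only, no named facts, no definitions) of `TateModuleKernelIndexProofs`,
assembling Milne's proof of Prop. 12.9 (= Mumford, *Abelian Varieties*, §19 Thm. 4, "`deg = det`") in
the generic Tate-module setting of `TateModuleRank`: an abelian group `A` with `#A[p^n] = p^{dn}` for all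
`n` and an endomorphism `φ ∈ End(A)`.  The GEOMETRY of the printed proof is abstracted into a
*degree function* on `ℤ[X] → End(A)`, `F ↦ F(φ)`:

* `δ : ℤ[X] → ℤ` multiplicative (`hmul`; `deg(αβ) = deg α deg β`),
* polynomial in the coefficients on monic polynomials of each degree (`hpoly`; Milne Prop. 12.4 /
  Mumford §19 Thm. 2, the theorem of the cube),
* with "characteristic polynomial" `P ∈ ℤ[X]` monic, `P(n) = δ(X - n)` (`hPδ`),
* and, for every monic `F` with `δ(F) ≠ 0` (i.e. `F(φ)` an isogeny), the `p`-power torsion of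
  `ker F(φ)` finite of order `p^{v_p(δ F)}` (`hker`; `deg = #ker` up to the inseparable degree, a power
  of the characteristic `≠ p`).

Conclusion (`TateModule.charpoly_toMatrix_map_eq_of_degreeFunction`,
`TateModule.charpoly_map_eq_of_degreeFunction`): **`P` is the characteristic polynomial of `T_p(φ)`**.
The proof is Milne's: `|δ(F)|_p = #(ker F(φ))(p)⁻¹ = #Coker(T_p F(φ))⁻¹ = |det T_p(F(φ))|_p`
(`TateModuleKernelIndexProofs`) for monic `F` with `δ(F) ≠ 0`, whence `charpoly = P` by Lemmas 12.10 and
12.11 (`Literature.Algebra.Polynomial.MultiplicativeDegree.charpoly_eq_of_multiplicative_polynomial_norm`).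
The degenerate monic `F` with `δ(F) = 0` (where the printed proof silently uses `deg = 0 ⇒` not an
isogeny `⇒ det = 0`) are handled here WITHOUT further geometric input, by perturbation: if
`det F(T_p φ) ≠ 0`, then for `G = F + p^N` (`N ≫ 0`) one has `δ(G) ≠ 0`,
`|δ(G)|_p ≤ p^{-N}` (some root `a` of `P` has `F(a) = 0`, by Lemma 12.11) and
`|det G(T_p φ)|_p = |det F(T_p φ)|_p` (`det` is `p`-adically continuous), contradicting `hker` for `G`.

Also: `TateModule.map_aeval` (`T_p(F(φ)) = F(T_p φ)`), and the consequence for Frobenius-type counts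
`TateModule.det_one_sub_map_pow_eq_of_degreeFunction`:
**`(-1)^{d(r+1)} δ(X^r - 1) = det(1 - T_p(φ)^r)`** in `ℤ_p` (so `= δ(X^r - 1)` for even `d = 2g`), and its
`V_p = ℚ_p ⊗ T_p` form for a monoid action (`RationalTateModule.det_one_sub_pow_eq_of_degreeFunction`).

What is NOT here (the geometric input a user must supply): the existence of such a `δ` for the
Jacobian / Picard group of a curve (`δ(F) = deg F(φ)`), i.e. Mumford §19 Thm. 2 with `deg = #ker` for
separable isogenies.

## References

* [Milne1986AbelianVarieties] J. S. Milne, *Abelian varieties*, in Cornell–Silverman (eds.), *Arithmetic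
  Geometry* (1986), §12: Prop. 12.4, Prop. 12.9 with its proof, Lemmas 12.10–12.11 (p. 125, PDF p. 193 of
  the held copy).
* [MumfordAV1970] D. Mumford, *Abelian Varieties* (1970), §19, Thm. 2 and Thm. 4.
-/

noncomputable section

open scoped Classical AddSubgroup TensorProduct
open Polynomial Literature.Algebra.Polynomial

universe u

namespace Literature.NumberTheory.EllipticCurves

namespace TateModule

variable {A : Type u} [AddCommGroup A] {p : ℕ} [Fact p.Prime]

/-! ### `T_p(F(φ)) = F(T_p φ)` -/

/-- **`T_p` is a ring homomorphism `End(A) → End_{ℤ_p}(T_p A)`**, hence commutes with polynomial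
expressions: `T_p(F(φ)) = F(T_p(φ))` for `F ∈ ℤ[X]`. [folklore] -/
theorem map_aeval (φ : AddMonoid.End A) (F : ℤ[X]) :
    map p (aeval φ F : AddMonoid.End A) = aeval (map p (φ : A →+ A)) F := by
  let ψ : AddMonoid.End A →+* Module.End ℤ_[p] (TateModule A p) :=
    { toFun := fun u => map p u
      map_one' := map_id
      map_mul' := fun u v => map_comp u v
      map_zero' := LinearMap.ext fun x => TateModule.ext fun n => by
        rw [proj_map]
        rfl
      map_add' := fun u v => LinearMap.ext fun x => TateModule.ext fun n => by
        rw [proj_map, LinearMap.add_apply, map_add, proj_map, proj_map]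
        rfl }
  exact (Polynomial.aeval_algHom_apply ψ.toIntAlgHom φ F).symm

/-- `det F(M) = det F(f)` for the matrix `M` of `f` in a basis (`LinearMap.toMatrix` is an algebra
isomorphism). [folklore] -/
theorem det_aeval_toMatrix {M : Type*} [AddCommGroup M] [Module ℤ_[p] M] {ι : Type*} [Fintype ι]
    [DecidableEq ι] (b : Module.Basis ι ℤ_[p] M) (f : Module.End ℤ_[p] M) (G : ℤ_[p][X]) :
    (aeval (LinearMap.toMatrix b b f) G).det = LinearMap.det (aeval f G) := by
  change (aeval (LinearMap.toMatrixAlgEquiv b f) G).det = _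
  rw [Polynomial.aeval_algHom_apply (LinearMap.toMatrixAlgEquiv b) f G]
  exact LinearMap.det_toMatrix b _

/-- `|z|_p = p^{-v_p(z)}` for a non-zero integer `z`. [folklore] -/
theorem norm_intCast_padic_eq {z : ℤ} (hz : z ≠ 0) :
    ‖(z : ℚ_[p])‖ = ((p : ℝ) ^ padicValInt p z)⁻¹ := by
  have h := Padic.eq_padicNorm (p := p) (z : ℚ)
  rw [Rat.cast_intCast] at h
  rw [h, padicNorm.eq_zpow_of_nonzero (by exact_mod_cast hz), padicValRat.of_int, zpow_neg, zpow_natCast]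
  push_cast
  rfl

/-- `p`-adic continuity of the determinant at precision `p^N`:
`|det(B + p^N) - det B|_p ≤ p^{-N}` (both determinants agree modulo `p^N`). [folklore] -/
theorem norm_det_add_pow_smul_one_sub_det_le {ι : Type*} [Fintype ι] [DecidableEq ι]
    (B : Matrix ι ι ℤ_[p]) (N : ℕ) :
    ‖(B + (p : ℤ_[p]) ^ N • (1 : Matrix ι ι ℤ_[p])).det - B.det‖ ≤ (p : ℝ) ^ (-(N : ℤ)) := by
  rw [PadicInt.norm_le_pow_iff_mem_span_pow, ← PadicInt.ker_toZModPow, RingHom.mem_ker, map_sub,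
    RingHom.map_det, RingHom.map_det, sub_eq_zero]
  congr 1
  ext i j
  simp only [RingHom.mapMatrix_apply, Matrix.map_apply, Matrix.add_apply, Matrix.smul_apply,
    smul_eq_mul, map_add, map_mul, map_pow, map_natCast]
  rw [← Nat.cast_pow, ZMod.natCast_self, zero_mul, add_zero]

/-- In a normed field, a product of elements of norm `≤ 1` has norm `≤ 1`. [folklore] -/
private theorem norm_multiset_prod_le_one {K : Type*} [NormedField K] {S : Type*} (s : Multiset S)
    (g : S → K) (h : ∀ a ∈ s, ‖g a‖ ≤ 1) : ‖(s.map g).prod‖ ≤ 1 := by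
  induction s using Multiset.induction_on with
  | empty => simp
  | cons a s ih =>
    rw [Multiset.map_cons, Multiset.prod_cons, norm_mul]
    exact mul_le_one₀ (h a (Multiset.mem_cons_self a s)) (norm_nonneg _)
      (ih fun b hb => h b (Multiset.mem_cons_of_mem hb))

/-! ### The degenerate case `δ(F) = 0` by perturbation -/

section Degenerate

variable {δ : ℤ[X] → ℤ} {P : ℤ[X]}

/-- If `δ` is multiplicative with `P(n) = δ(X - n)`, `P` monic, then `δ(1) ≠ 0`-type non-degeneracy:
a monic `F` with `δ(F) = 0` has positive degree. [folklore] -/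
private theorem natDegree_pos_of_delta_eq_zero (hmul : ∀ F G : ℤ[X], δ (F * G) = δ F * δ G)
    (hP : P.Monic) (hPδ : ∀ m : ℤ, P.eval m = δ (X - C m)) {F : ℤ[X]} (hF : F.Monic) (hδ : δ F = 0) :
    0 < F.natDegree := by
  rw [Nat.pos_iff_ne_zero]
  intro h0
  have hF1 : F = 1 := (hF.natDegree_eq_zero).mp h0
  have hPm : ∀ m : ℤ, P.eval (m : ℤ) = 0 := fun m => by
    rw [hPδ, ← one_mul (X - C m), hmul, ← hF1, hδ, zero_mul]
  obtain ⟨m, hm⟩ := Infinite.exists_notMem_finset P.roots.toFinset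
  exact hm (Multiset.mem_toFinset.mpr ((mem_roots hP.ne_zero).mpr (hPm m)))

/-- **Lemma 12.11 in `\overline{ℚ_p}`, swapped**: `δ(G) = ± ∏_{P(a) = 0} G(a)` for monic `G`. [cite:
Milne1986AbelianVarieties, §12, Lemma 12.11] -/
private theorem cast_delta_eq_sign_mul_prod (hmul : ∀ F G : ℤ[X], δ (F * G) = δ F * δ G)
    (hP : P.Monic) (hPδ : ∀ m : ℤ, P.eval m = δ (X - C m))
    (hpoly : ∀ e : ℕ, ∃ H : MvPolynomial (Fin e) ℚ, ∀ c : Fin e → ℤ,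
      (δ (X ^ e + ∑ k : Fin e, C (c k) * X ^ (k : ℕ)) : ℚ) = MvPolynomial.eval (fun k => (c k : ℚ)) H)
    {G : ℤ[X]} (hG : G.Monic) :
    ((δ G : ℤ) : PadicAlgCl p) = (-1) ^ (G.natDegree * P.natDegree) *
      ((P.map (Int.castRingHom (PadicAlgCl p))).roots.map
        fun a => (G.map (Int.castRingHom (PadicAlgCl p))).eval a).prod := by
  have h := MultiplicativeDegree.cast_delta_eq_prod_eval_roots hmul hP hPδ hpoly (S := PadicAlgCl p) hG
    (IsAlgClosed.splits _)
  rwa [MultiplicativeDegree.prod_eval_roots_swap (hG.map _) (hP.map _) (IsAlgClosed.splits _)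
    (IsAlgClosed.splits _), hG.natDegree_map, hP.natDegree_map] at h

/-- **The degenerate case of Milne's `hnorm`, by perturbation.**  Let `δ`, `P` be as in
`MultiplicativeDegree.charpoly_eq_of_multiplicative_polynomial_norm` and `M` a square matrix over `ℤ_p`
with `|δ(G)|_p = |det G(M)|_p` for all monic `G` with `δ(G) ≠ 0`.  Then `det F(M) = 0` for every monic
`F` with `δ(F) = 0`: otherwise, for `G = F + p^N` with `p^{-N}` below `|det F(M)|_p` and below every
non-zero `|F(a)|`, `a` a root of `P`, one gets `δ(G) ≠ 0` but
`|det F(M)|_p = |det G(M)|_p = |δ(G)|_p ≤ p^{-N}`.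
[cite: Milne1986AbelianVarieties, §12, proof of Prop. 12.9] -/
theorem det_aeval_eq_zero_of_delta_eq_zero (hmul : ∀ F G : ℤ[X], δ (F * G) = δ F * δ G)
    (hP : P.Monic) (hPδ : ∀ m : ℤ, P.eval m = δ (X - C m))
    (hpoly : ∀ e : ℕ, ∃ H : MvPolynomial (Fin e) ℚ, ∀ c : Fin e → ℤ,
      (δ (X ^ e + ∑ k : Fin e, C (c k) * X ^ (k : ℕ)) : ℚ) = MvPolynomial.eval (fun k => (c k : ℚ)) H)
    {ι : Type*} [Fintype ι] [DecidableEq ι] (M : Matrix ι ι ℤ_[p])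
    (hnorm : ∀ G : ℤ[X], G.Monic → δ G ≠ 0 →
      ‖((δ G : ℤ) : ℚ_[p])‖ = ‖(aeval M (G.map (Int.castRingHom ℤ_[p]))).det‖)
    {F : ℤ[X]} (hF : F.Monic) (hδ : δ F = 0) :
    (aeval M (F.map (Int.castRingHom ℤ_[p]))).det = 0 := by
  have hp : p.Prime := Fact.out
  by_contra hdet
  set B := aeval M (F.map (Int.castRingHom ℤ_[p])) with hB
  set S := (P.map (Int.castRingHom (PadicAlgCl p))).roots with hS
  set FK := F.map (Int.castRingHom (PadicAlgCl p)) with hFK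
  have hF0 := natDegree_pos_of_delta_eq_zero hmul hP hPδ hF hδ
  -- a root `a₀` of `P` with `F(a₀) = 0`
  have h0 : (0 : PadicAlgCl p) ∈ S.map fun a => FK.eval a := by
    have h := cast_delta_eq_sign_mul_prod (p := p) hmul hP hPδ hpoly hF
    rw [hδ, Int.cast_zero, zero_eq_mul] at h
    rcases h with h | h
    · exact absurd h (pow_ne_zero _ (neg_ne_zero.mpr one_ne_zero))
    · exact Multiset.prod_eq_zero_iff.mp h
  obtain ⟨a₀, ha₀S, ha₀⟩ := Multiset.mem_map.mp h0
  -- choose the precision `N`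
  obtain ⟨ε, hε, hεle⟩ := PadicInt.exists_pos_le_of_forall_pos
    (‖B.det‖ ::ₘ ((S.filter fun a => FK.eval a ≠ 0).map fun a => ‖FK.eval a‖)) (by
      intro x hx
      rcases Multiset.mem_cons.mp hx with rfl | hx
      · exact norm_pos_iff.mpr hdet
      · obtain ⟨a, ha, rfl⟩ := Multiset.mem_map.mp hx
        exact norm_pos_iff.mpr (Multiset.mem_filter.mp ha).2)
  have hp1 : (1 : ℝ) < p := by exact_mod_cast hp.one_lt
  obtain ⟨N, hN⟩ := exists_pow_lt_of_lt_one hε (inv_lt_one_of_one_lt₀ hp1)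
  have hpN : (p : ℝ) ^ (-(N : ℤ)) < ε := by rwa [zpow_neg, zpow_natCast, ← inv_pow]
  -- the perturbation `G = F + p^N`
  set G : ℤ[X] := F + C ((p : ℤ) ^ N) with hG
  have hGm : G.Monic := hF.add_of_left (degree_C_le.trans_lt (by
    rw [Polynomial.degree_eq_natDegree hF.ne_zero]; exact_mod_cast hF0))
  have hGK : ∀ a : PadicAlgCl p, (G.map (Int.castRingHom (PadicAlgCl p))).eval a =
      FK.eval a + (p : PadicAlgCl p) ^ N := by
    intro a
    rw [hG, hFK, Polynomial.map_add, Polynomial.map_C, eval_add, eval_C, map_pow, map_natCast]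
  have hnp : ‖(p : PadicAlgCl p) ^ N‖ = (p : ℝ) ^ (-(N : ℤ)) := by
    rw [← map_natCast (algebraMap ℤ_[p] (PadicAlgCl p)), ← map_pow]
    exact PadicInt.norm_algebraMap_pow N
  -- `δ G ≠ 0`: a root `a` of `P` with `G(a) = 0` has `|F(a)| = p^{-N}`, excluded by the choice of `N`
  have hδG : δ G ≠ 0 := by
    intro hG0
    have h := cast_delta_eq_sign_mul_prod (p := p) hmul hP hPδ hpoly hGm
    rw [hG0, Int.cast_zero, zero_eq_mul] at h
    rcases h with h | h
    · exact absurd h (pow_ne_zero _ (neg_ne_zero.mpr one_ne_zero))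
    obtain ⟨a₁, ha₁S, ha₁⟩ := Multiset.mem_map.mp (Multiset.prod_eq_zero_iff.mp h)
    rw [hGK] at ha₁
    have hne : FK.eval a₁ ≠ 0 := fun h0' => by
      rw [h0', zero_add] at ha₁
      exact pow_ne_zero N (Nat.cast_ne_zero.mpr hp.ne_zero) ha₁
    have hnorm₁ : ‖FK.eval a₁‖ = (p : ℝ) ^ (-(N : ℤ)) := by
      rw [eq_neg_of_add_eq_zero_left ha₁, norm_neg, hnp]
    have hle := hεle ‖FK.eval a₁‖ (Multiset.mem_cons_of_mem
      (Multiset.mem_map.mpr ⟨a₁, Multiset.mem_filter.mpr ⟨ha₁S, hne⟩, rfl⟩))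
    rw [hnorm₁] at hle
    exact absurd (hpN.trans_le hle) (lt_irrefl _)
  -- `G(M) = F(M) + p^N`
  have hG' : aeval M (G.map (Int.castRingHom ℤ_[p])) = B + (p : ℤ_[p]) ^ N • (1 : Matrix ι ι ℤ_[p]) := by
    rw [hB, hG, Polynomial.map_add, Polynomial.map_C, map_add, aeval_C, Algebra.algebraMap_eq_smul_one,
      map_pow, map_natCast]
  -- `|det G(M)|_p = |det F(M)|_p`
  have hdetN : ‖(B + (p : ℤ_[p]) ^ N • (1 : Matrix ι ι ℤ_[p])).det‖ = ‖B.det‖ := by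
    have hlt : ‖(B + (p : ℤ_[p]) ^ N • (1 : Matrix ι ι ℤ_[p])).det - B.det‖ < ‖B.det‖ :=
      (norm_det_add_pow_smul_one_sub_det_le B N).trans_lt
        (hpN.trans_le (hεle _ (Multiset.mem_cons_self _ _)))
    have h := PadicInt.norm_add_eq_max_of_ne hlt.ne
    rwa [sub_add_cancel, max_eq_right hlt.le] at h
  -- `|δ G|_p ≤ p^{-N}`
  have hδle : ‖((δ G : ℤ) : ℚ_[p])‖ ≤ (p : ℝ) ^ (-(N : ℤ)) := by
    rw [← PadicAlgCl.norm_extends p (((δ G : ℤ) : ℚ_[p])), map_intCast,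
      cast_delta_eq_sign_mul_prod (p := p) hmul hP hPδ hpoly hGm, norm_mul, norm_pow, norm_neg, norm_one,
      one_pow, one_mul]
    obtain ⟨S', hS'⟩ := Multiset.exists_cons_of_mem ha₀S
    rw [← hS, hS', Multiset.map_cons, Multiset.prod_cons, norm_mul, hGK, ha₀, zero_add, hnp]
    refine mul_le_of_le_one_right (zpow_nonneg (Nat.cast_nonneg _) _)
      (norm_multiset_prod_le_one S' _ fun a ha => ?_)
    rw [hGK]
    have ha1 : ‖a‖ ≤ 1 := by
      refine PadicInt.norm_le_one_of_mem_roots_map (hP.map (Int.castRingHom ℤ_[p])) ?_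
      rw [Polynomial.map_map, RingHom.ext_int ((algebraMap ℤ_[p] (PadicAlgCl p)).comp
        (Int.castRingHom ℤ_[p])) (Int.castRingHom (PadicAlgCl p)), ← hS, hS']
      exact Multiset.mem_cons_of_mem ha
    refine (IsUltrametricDist.norm_add_le_max _ _).trans (max_le ?_ ?_)
    · have h := PadicInt.norm_eval_map_le_of_coeff_le (D := F.map (Int.castRingHom ℤ_[p])) zero_le_one
        (fun j => PadicInt.norm_le_one _) ha1
      rwa [Polynomial.map_map, RingHom.ext_int ((algebraMap ℤ_[p] (PadicAlgCl p)).comp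
        (Int.castRingHom ℤ_[p])) (Int.castRingHom (PadicAlgCl p))] at h
    · rw [hnp]
      exact zpow_le_one_of_nonpos₀ hp1.le (by omega)
  -- contradiction
  have h := hnorm G hGm hδG
  rw [hG', hdetN] at h
  have key : ‖B.det‖ < ‖B.det‖ :=
    calc ‖B.det‖ = ‖((δ G : ℤ) : ℚ_[p])‖ := h.symm
      _ ≤ (p : ℝ) ^ (-(N : ℤ)) := hδle
      _ < ε := hpN
      _ ≤ ‖B.det‖ := hεle _ (Multiset.mem_cons_self _ _)
  exact lt_irrefl _ key

end Degenerate

/-! ### Milne's Prop. 12.9 for `T_p(φ)` -/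

variable {d : ℕ}

/-- **Milne, *Abelian Varieties*, Prop. 12.9 / Mumford §19 Thm. 4 (`deg = det`), Tate-module form.**
Let `A` be an abelian group with `#A[p^n] = p^{dn}` for all `n`, `φ ∈ End(A)`, and `δ : ℤ[X] → ℤ` a
multiplicative function, polynomial in the coefficients on monic polynomials of each degree, with
`P(n) = δ(X - n)` for a monic `P ∈ ℤ[X]`, such that for every monic `F` with `δ(F) ≠ 0` the `p`-power
torsion of `ker F(φ)` is finite of order `p^{v_p(δ(F))}` (for the degree function of an abelian variety:
`F(φ)` is an isogeny and `#(ker F(φ))(p) = |deg F(φ)|_p⁻¹`).  Then `P` is the characteristic polynomial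
of `T_p(φ)` in any `ℤ_p`-basis of `T_p A`.
[cite: Milne1986AbelianVarieties, §12, Prop. 12.9 (proof, p. 125)] [cite: MumfordAV1970, §19, Thm. 4] -/
theorem charpoly_toMatrix_map_eq_of_degreeFunction
    (hcard : ∀ n, Nat.card (A[(p ^ n : ℕ)]) = p ^ (d * n)) (φ : AddMonoid.End A)
    {δ : ℤ[X] → ℤ} (hmul : ∀ F G : ℤ[X], δ (F * G) = δ F * δ G)
    {P : ℤ[X]} (hP : P.Monic) (hPδ : ∀ m : ℤ, P.eval m = δ (X - C m))
    (hpoly : ∀ e : ℕ, ∃ H : MvPolynomial (Fin e) ℚ, ∀ c : Fin e → ℤ,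
      (δ (X ^ e + ∑ k : Fin e, C (c k) * X ^ (k : ℕ)) : ℚ) = MvPolynomial.eval (fun k => (c k : ℚ)) H)
    (hker : ∀ F : ℤ[X], F.Monic → δ F ≠ 0 →
      {a : A | (∃ n : ℕ, p ^ n • a = 0) ∧ (aeval φ F : AddMonoid.End A) a = 0}.Finite ∧
        Nat.card {a : A | (∃ n : ℕ, p ^ n • a = 0) ∧ (aeval φ F : AddMonoid.End A) a = 0} =
          p ^ padicValInt p (δ F))
    {ι : Type*} [Fintype ι] [DecidableEq ι] (b : Module.Basis ι ℤ_[p] (TateModule A p)) :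
    (LinearMap.toMatrix b b (map p (φ : A →+ A))).charpoly = P.map (Int.castRingHom ℤ_[p]) := by
  have hp : p.Prime := Fact.out
  -- `|δ F|_p = |det F(T_p φ)|_p` for monic `F` with `δ F ≠ 0` (the kernel/cokernel count)
  have hnorm : ∀ F : ℤ[X], F.Monic → δ F ≠ 0 →
      ‖((δ F : ℤ) : ℚ_[p])‖ = ‖(aeval (LinearMap.toMatrix b b (map p (φ : A →+ A)))
        (F.map (Int.castRingHom ℤ_[p]))).det‖ := by
    intro F hF hδ
    obtain ⟨hfin, hc⟩ := hker F hF hδ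
    rw [det_aeval_toMatrix, show Int.castRingHom ℤ_[p] = algebraMap ℤ ℤ_[p] from
      (algebraMap_int_eq ℤ_[p]).symm, Polynomial.aeval_map_algebraMap, ← map_aeval,
      norm_det_map_eq_inv_natCard hcard _ hfin, norm_intCast_padic_eq hδ]
    congr 1
    exact_mod_cast hc.symm
  refine Literature.Algebra.Polynomial.MultiplicativeDegree.charpoly_eq_of_multiplicative_polynomial_norm
    _ hmul hP hPδ hpoly fun F hF => ?_
  by_cases hδ : δ F = 0
  · rw [det_aeval_eq_zero_of_delta_eq_zero hmul hP hPδ hpoly _ hnorm hF hδ, hδ, Int.cast_zero, norm_zero,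
      norm_zero]
  · exact hnorm F hF hδ

/-- **`deg = det`, basis-free**: under the hypotheses of
`charpoly_toMatrix_map_eq_of_degreeFunction`, `P` is the characteristic polynomial of the
`ℤ_p`-linear map `T_p(φ)` of the finite free `ℤ_p`-module `T_p A`.
[cite: Milne1986AbelianVarieties, §12, Prop. 12.9] [cite: MumfordAV1970, §19, Thm. 4] -/
theorem charpoly_map_eq_of_degreeFunction [Module.Free ℤ_[p] (TateModule A p)]
    [Module.Finite ℤ_[p] (TateModule A p)]
    (hcard : ∀ n, Nat.card (A[(p ^ n : ℕ)]) = p ^ (d * n)) (φ : AddMonoid.End A)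
    {δ : ℤ[X] → ℤ} (hmul : ∀ F G : ℤ[X], δ (F * G) = δ F * δ G)
    {P : ℤ[X]} (hP : P.Monic) (hPδ : ∀ m : ℤ, P.eval m = δ (X - C m))
    (hpoly : ∀ e : ℕ, ∃ H : MvPolynomial (Fin e) ℚ, ∀ c : Fin e → ℤ,
      (δ (X ^ e + ∑ k : Fin e, C (c k) * X ^ (k : ℕ)) : ℚ) = MvPolynomial.eval (fun k => (c k : ℚ)) H)
    (hker : ∀ F : ℤ[X], F.Monic → δ F ≠ 0 →
      {a : A | (∃ n : ℕ, p ^ n • a = 0) ∧ (aeval φ F : AddMonoid.End A) a = 0}.Finite ∧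
        Nat.card {a : A | (∃ n : ℕ, p ^ n • a = 0) ∧ (aeval φ F : AddMonoid.End A) a = 0} =
          p ^ padicValInt p (δ F)) :
    (map p (φ : A →+ A)).charpoly = P.map (Int.castRingHom ℤ_[p]) := by
  rw [← LinearMap.charpoly_toMatrix _ (Module.Free.chooseBasis ℤ_[p] (TateModule A p))]
  exact charpoly_toMatrix_map_eq_of_degreeFunction hcard φ hmul hP hPδ hpoly hker _

/-- The rank is the degree of `P`: `d = deg P`. [cite: Milne1986AbelianVarieties, §12, Prop. 12.9] -/
theorem natDegree_eq_of_degreeFunction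
    (hcard : ∀ n, Nat.card (A[(p ^ n : ℕ)]) = p ^ (d * n)) (φ : AddMonoid.End A)
    {δ : ℤ[X] → ℤ} (hmul : ∀ F G : ℤ[X], δ (F * G) = δ F * δ G)
    {P : ℤ[X]} (hP : P.Monic) (hPδ : ∀ m : ℤ, P.eval m = δ (X - C m))
    (hpoly : ∀ e : ℕ, ∃ H : MvPolynomial (Fin e) ℚ, ∀ c : Fin e → ℤ,
      (δ (X ^ e + ∑ k : Fin e, C (c k) * X ^ (k : ℕ)) : ℚ) = MvPolynomial.eval (fun k => (c k : ℚ)) H)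
    (hker : ∀ F : ℤ[X], F.Monic → δ F ≠ 0 →
      {a : A | (∃ n : ℕ, p ^ n • a = 0) ∧ (aeval φ F : AddMonoid.End A) a = 0}.Finite ∧
        Nat.card {a : A | (∃ n : ℕ, p ^ n • a = 0) ∧ (aeval φ F : AddMonoid.End A) a = 0} =
          p ^ padicValInt p (δ F)) :
    P.natDegree = d := by
  haveI := free_of_card_torsionBy_rank hcard
  haveI := finite_of_card_torsionBy_rank hcard
  have h := congrArg natDegree (charpoly_map_eq_of_degreeFunction hcard φ hmul hP hPδ hpoly hker)
  rwa [LinearMap.charpoly_natDegree, finrank_eq_of_card_torsionBy hcard, hP.natDegree_map, eq_comm] at h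

/-! ### `det(1 - T_p(φ)^r) = ± δ(X^r - 1)` -/

/-- `ℤ_p → \overline{ℚ_p}` is injective. [folklore] -/
private theorem algebraMap_padicAlgCl_injective :
    Function.Injective (algebraMap ℤ_[p] (PadicAlgCl p)) := by
  rw [IsScalarTower.algebraMap_eq ℤ_[p] ℚ_[p] (PadicAlgCl p)]
  exact (algebraMap ℚ_[p] (PadicAlgCl p)).injective.comp (IsFractionRing.injective ℤ_[p] ℚ_[p])

/-- **`(-1)^{d(r+1)} δ(X^r - 1) = det(1 - T_p(φ)^r)`** (`r ≥ 1`) under the hypotheses of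
`charpoly_toMatrix_map_eq_of_degreeFunction`: with `a₁, …, a_d` the roots of `P = charpoly T_p(φ)`,
`det(1 - T_p(φ)^r) = ∏ᵢ (1 - aᵢ^r)` (spectral mapping) and `δ(X^r - 1) = ∏_{b^r = 1} P(b) =
(-1)^{rd} ∏ᵢ (aᵢ^r - 1)` (Lemma 12.11).  For even `d = 2g` this is `δ(X^r - 1) = det(1 - T_p(φ)^r)`,
i.e. `deg(φ^r - 1) = det(1 - T_p(φ)^r)` — the form in which the fixed points of the `r`-th power of a
Frobenius are counted (Mumford §19 Thm. 4 applied to `1 - π^r`, §21).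
[cite: Milne1986AbelianVarieties, §12, Prop. 12.9, and §19, Thm. 19.1 (proof)]
[cite: MumfordAV1970, §19 Thm. 4, §21] -/
theorem det_one_sub_map_pow_eq_of_degreeFunction [Module.Free ℤ_[p] (TateModule A p)]
    [Module.Finite ℤ_[p] (TateModule A p)]
    (hcard : ∀ n, Nat.card (A[(p ^ n : ℕ)]) = p ^ (d * n)) (φ : AddMonoid.End A)
    {δ : ℤ[X] → ℤ} (hmul : ∀ F G : ℤ[X], δ (F * G) = δ F * δ G)
    {P : ℤ[X]} (hP : P.Monic) (hPδ : ∀ m : ℤ, P.eval m = δ (X - C m))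
    (hpoly : ∀ e : ℕ, ∃ H : MvPolynomial (Fin e) ℚ, ∀ c : Fin e → ℤ,
      (δ (X ^ e + ∑ k : Fin e, C (c k) * X ^ (k : ℕ)) : ℚ) = MvPolynomial.eval (fun k => (c k : ℚ)) H)
    (hker : ∀ F : ℤ[X], F.Monic → δ F ≠ 0 →
      {a : A | (∃ n : ℕ, p ^ n • a = 0) ∧ (aeval φ F : AddMonoid.End A) a = 0}.Finite ∧
        Nat.card {a : A | (∃ n : ℕ, p ^ n • a = 0) ∧ (aeval φ F : AddMonoid.End A) a = 0} =
          p ^ padicValInt p (δ F))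
    {r : ℕ} (hr : 0 < r) :
    (((-1) ^ (d * (r + 1)) * δ (X ^ r - 1) : ℤ) : ℤ_[p]) = LinearMap.det (1 - map p (φ : A →+ A) ^ r) := by
  have hchar := charpoly_toMatrix_map_eq_of_degreeFunction hcard φ hmul hP hPδ hpoly hker
    (Module.Free.chooseBasis ℤ_[p] (TateModule A p))
  have hd := natDegree_eq_of_degreeFunction hcard φ hmul hP hPδ hpoly hker
  have hr0 : r ≠ 0 := Nat.pos_iff_ne_zero.mp hr
  have hFm : (X ^ r - 1 : ℤ[X]).Monic := by simpa using monic_X_pow_sub_C (1 : ℤ) hr0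
  have hFd : (X ^ r - 1 : ℤ[X]).natDegree = r := by
    simpa using natDegree_X_pow_sub_C (n := r) (r := (1 : ℤ))
  have hS : Multiset.card (P.map (Int.castRingHom (PadicAlgCl p))).roots = d := by
    rw [← (IsAlgClosed.splits (P.map (Int.castRingHom (PadicAlgCl p)))).natDegree_eq_card_roots,
      hP.natDegree_map, hd]
  apply algebraMap_padicAlgCl_injective
  -- the left side in `\overline{ℚ_p}`: `± ∏_{P(a)=0} (a^r - 1)` (Lemma 12.11)
  rw [map_intCast, Int.cast_mul, Int.cast_pow, Int.cast_neg, Int.cast_one,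
    cast_delta_eq_sign_mul_prod (p := p) hmul hP hPδ hpoly hFm, hFd, hd]
  -- the right side: `∏_{P(a)=0} (1 - a^r)` (spectral mapping, `charpoly = P`)
  have h1 : (1 - map p (φ : A →+ A) ^ r) = aeval (map p (φ : A →+ A)) ((1 - X ^ r : ℤ_[p][X])) := by
    simp only [map_sub, map_one, map_pow, aeval_X]
  rw [h1, ← det_aeval_toMatrix (Module.Free.chooseBasis ℤ_[p] (TateModule A p)), RingHom.map_det,
    PadicInt.mapMatrix_aeval,
    Literature.NumberTheory.LFunctions.FrobeniusCharpoly.det_aeval_eq_prod_roots, Matrix.charpoly_map,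
    hchar, Polynomial.map_map, RingHom.ext_int ((algebraMap ℤ_[p] (PadicAlgCl p)).comp
      (Int.castRingHom ℤ_[p])) (Int.castRingHom (PadicAlgCl p))]
  have hL : ((P.map (Int.castRingHom (PadicAlgCl p))).roots.map fun a =>
      ((X ^ r - 1 : ℤ[X]).map (Int.castRingHom (PadicAlgCl p))).eval a) =
        (P.map (Int.castRingHom (PadicAlgCl p))).roots.map fun a => a ^ r - 1 :=
    Multiset.map_congr rfl fun a _ => by simp
  have hR : ((P.map (Int.castRingHom (PadicAlgCl p))).roots.map fun a =>
      ((1 - X ^ r : ℤ_[p][X]).map (algebraMap ℤ_[p] (PadicAlgCl p))).eval a) =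
        (P.map (Int.castRingHom (PadicAlgCl p))).roots.map fun a => (-1) * (a ^ r - 1) :=
    Multiset.map_congr rfl fun a _ => by simp
  rw [hL, hR, Multiset.prod_map_mul, Multiset.map_const', Multiset.prod_replicate, hS, ← mul_assoc,
    ← pow_add, show d * (r + 1) + r * d = d + 2 * (r * d) by ring, pow_add, pow_mul, neg_one_sq, one_pow,
    mul_one]

/-! ### Monoid actions: `φ = (a ↦ g • a)`, `T_p(φ) = ρ_T(g)`, `V_p` -/

section Action

variable {G : Type*} [Monoid G] [DistribMulAction G A]

/-- `T_p` of the endomorphism `a ↦ g • a` is `tateRepresentation g`. [folklore] -/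
theorem map_toAddMonoidEnd (g : G) :
    map p (DistribMulAction.toAddMonoidEnd G A g : A →+ A) = tateRepresentation G A p g := by
  refine LinearMap.ext fun x => TateModule.ext fun n => ?_
  rw [proj_map, tateRepresentation_apply_apply, proj_smul_of_distribMulAction]
  rfl

end Action

end TateModule

namespace RationalTateModule

variable {A : Type u} [AddCommGroup A] {p : ℕ} [Fact p.Prime] {d : ℕ}
variable {G : Type*} [Monoid G] [DistribMulAction G A]

/-- **`det(1 - g^r | V_p A) = (-1)^{d(r+1)} δ(X^r - 1)`** for a monoid `G` acting on `A` with
`#A[p^n] = p^{dn}`, `g ∈ G`, and a degree function `δ` for the endomorphism `a ↦ g • a` as in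
`TateModule.charpoly_toMatrix_map_eq_of_degreeFunction` — the `V_p = ℚ_p ⊗ T_p` form of
`TateModule.det_one_sub_map_pow_eq_of_degreeFunction` (for even `d`: `det(1 - g^r | V_p A) = δ(X^r - 1)
= deg(g^r - 1)`, Mumford §19 Thm. 4 / §21 for a Frobenius `g = π`).
[cite: Milne1986AbelianVarieties, §12, Prop. 12.9; §19, Thm. 19.1 (proof)] [cite: MumfordAV1970, §19 Thm. 4, §21] -/
theorem det_one_sub_pow_eq_of_degreeFunction [Module.Free ℤ_[p] (TateModule A p)]
    [Module.Finite ℤ_[p] (TateModule A p)]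
    (hcard : ∀ n, Nat.card (A[(p ^ n : ℕ)]) = p ^ (d * n)) (g : G)
    {δ : ℤ[X] → ℤ} (hmul : ∀ F G : ℤ[X], δ (F * G) = δ F * δ G)
    {P : ℤ[X]} (hP : P.Monic) (hPδ : ∀ m : ℤ, P.eval m = δ (X - C m))
    (hpoly : ∀ e : ℕ, ∃ H : MvPolynomial (Fin e) ℚ, ∀ c : Fin e → ℤ,
      (δ (X ^ e + ∑ k : Fin e, C (c k) * X ^ (k : ℕ)) : ℚ) = MvPolynomial.eval (fun k => (c k : ℚ)) H)
    (hker : ∀ F : ℤ[X], F.Monic → δ F ≠ 0 →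
      {a : A | (∃ n : ℕ, p ^ n • a = 0) ∧
          (aeval (DistribMulAction.toAddMonoidEnd G A g) F : AddMonoid.End A) a = 0}.Finite ∧
        Nat.card {a : A | (∃ n : ℕ, p ^ n • a = 0) ∧
          (aeval (DistribMulAction.toAddMonoidEnd G A g) F : AddMonoid.End A) a = 0} =
            p ^ padicValInt p (δ F))
    {r : ℕ} (hr : 0 < r) :
    LinearMap.det (1 - rationalTateRepresentation G A p g ^ r) =
      (((-1) ^ (d * (r + 1)) * δ (X ^ r - 1) : ℤ) : ℚ_[p]) := by
  rw [← map_pow, det_one_sub_rationalTateRepresentation, map_pow, ← TateModule.map_toAddMonoidEnd,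
    ← TateModule.det_one_sub_map_pow_eq_of_degreeFunction hcard _ hmul hP hPδ hpoly hker hr]
  norm_cast

end RationalTateModule

end Literature.NumberTheory.EllipticCurves
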